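import Summits.QuantumFields.BalabanUV.Beta.D1BFx.CornerVBlockRank
import Summits.QuantumFields.BalabanUV.Beta.D1BFx.GaugeJetLocal

/-!
# `BalabanUV.Beta.D1BFx.SbRblkAnatomy` — road «BF-x» for binder row D1, slot (REST′), rows A3.a′∕A3.b′, STRUCTURE: THE PROJECTOR SECTOR `SbRblk`
# ENTRYWISE — the double difference `dSw` of the rank-structured `Rdot` (`CornerVBlockRank.Rdot_apply_road`) is «`cK`·(double difference of the
# antisymmetrised dipole) − (difference of the needle row) × (difference of the combined column) + (mirror)», minus the explicit `dJetSw` term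

HONEST DEPENDENCY (page 1, mandatory): continuum YM on T⁴ ⇐ BetaPertH ∧ nine spine estimates (0/9 proved); BetaPertH ⇐ (D1) ∧ (D4) ∧
CAP+tail; G-an2-4 gates asym, D1 and NE2/3/4.  HONEST FRAMING (cell contract, verbatim): «discharging `BetaPertH` makes Bałaban's UV
stability UNCONDITIONAL — a real constructive-QFT result; it is NOT the continuum limit and NOT the Clay problem.»  THIS MODULE DISCHARGES
NOTHING of the wall: [folklore] algebra over leaf-05-g3's `RJetAssembly.dSw ∕ dJetSw`, the owner's `GaugeJetLocal.SbRblk` and this lineage's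
`CornerVBlockRank.Rdot_apply_road` BY NAME; no `def`, no `def … : Prop`, nothing cited, 0 sorry.  0 wall binders; NOT the (REST′) word bounds, NOT (K),
NOT D1, NOT `BetaPertH`, NOT continuum, NOT Clay.

LITERAL NOTE (row-D1 owner R-D1-g25-1 ∕ road owner ρ-g7-2 (d), 2026-08-21): these are the COMB-TERM (`σ = id`) needles; for the permutation-symmetrised
literal of record `JsB12Sym` the first-order averaging jet is the `S_D`-mean of the `D!` permuted needles (linear), so every identity below applies
summand by summand.

ABSOLUTE RULE (cell charter, verbatim): «No internally-minted statement may enter as a cited fact. Every hypothesis is either kernel-proved in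
this package or a verbatim quotation of a PUBLISHED theorem with page reference. The manuscript(s) under audit are NOT citable for their own
disputed steps — they are the thing under adjudication; programme-internal (2001/route/tribunal) claims are never citable.»

WHY.  The A3.a′∕A3.b′ words pair the frozen-leg bubble with the stencil `SbRblk n a cK cQ κ u = dSw (Rdot n a cK cQ κ u) − dJetSw κ u (Pgt n a)`
(`GaugeJetLocal`); `dSw Y (x,α) (z,β) = Y(x+e_α,z+e_β) − Y(x+e_α,z) − Y(x,z+e_β) + Y(x,z)` is bilinear-friendly: on a tensor product `f ⊗ g` it is the
product of first differences.  With `Rdot_apply_road` (dipole + needle row ⊗ combined column, antisymmetrised) this gives the entry formula of the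
projector sector in which every `n`-sensitive factor is isolated: first differences of the NEEDLE ROW (mass `≤ sup|RG|·n^{κ−3}`,
`AveragingJetNeedle`∕`CornerJRankOne`) against first differences of the COMBINED COLUMN (zero-mass smearing of `kerP`, `CornerColumnZeroMass`).

CONTENT (all [folklore]):
* §1 the `dSw` calculus: `dSw_congr` (entrywise-determined), **`dSw_rankOne`** (`dSw (f ⊗ g) = Δf ⊗ Δg`), `dSw_add_fun`, `dSw_smul_fun`, `dSw_antisym_pair`.
* §2 **`SbRblk_apply_road`** — the entry formula of the projector sector on the road (`0 < a`), with the needle row `row`, the combined column `C` and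
  the dipole `D` passed as abbreviation hypotheses (instantiate with `fun _ => rfl`-proofs).
Provenance: D1 formalisation swarm, unit b2b-balaban-beta-d1-formalise-leaf-04 gen 6 (prover-b2b-balaban-beta-d1-formalise-leaf-04-g6-0), 2026-08-21;
sub-leaf «D1-BFx-A3a′-NEEDLE» of `LEAVES-BFx.md` (FILE 5).
-/

namespace Summit.QuantumFields.BalabanUV.Beta.D1BFx.SbRblkAnatomy

open Finset
open scoped BigOperators
open Literature.MathematicalPhysics.QuantumFieldTheory.Balaban1983to89
open Literature.MathematicalPhysics.QuantumFieldTheory.Balaban1983to89.Beta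
open B6QGQLower276 (blk B)
open ExpKernelCalculus (Site MKer)
open AffineAveraging (unitVec)
open RProjector (kerP Pgt)
open GhostLeg (Ggh)
open GhostStencil (qJet)
open RProjectorJet (RG Rdot)
open RJetAssembly (dSw dJetSw)
open GaugeJetLocal (SbRblk SbRblk_apply)
open CornerVBlockRank (Rdot_apply_road)

noncomputable section

/-! ## §1 The `dSw` calculus -/

/-- [folklore] `dSw` only sees the entries `Y x z () ()`: it may be computed from any entrywise formula. -/
theorem dSw_congr {Y : MKer 4 Unit} {F : Site 4 → Site 4 → ℝ} (h : ∀ x z : Site 4, Y x z () () = F x z) (x z : Site 4) (α β : Fin 4) :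
    dSw Y x z α β = F (x + unitVec α) (z + unitVec β) - F (x + unitVec α) z - F x (z + unitVec β) + F x z := by
  simp only [dSw, h]

/-- [folklore] **`dSw` OF A TENSOR PRODUCT IS THE PRODUCT OF FIRST DIFFERENCES**: `dSw (f ⊗ g) (x,α) (z,β) = (f(x+e_α) − f x)·(g(z+e_β) − g z)`. -/
theorem dSw_rankOne (f g : Site 4 → ℝ) (x z : Site 4) (α β : Fin 4) :
    dSw (fun x z _ _ => f x * g z) x z α β = (f (x + unitVec α) - f x) * (g (z + unitVec β) - g z) := by
  simp only [dSw]
  ring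

/-- [folklore] `dSw` is additive in the entry function. -/
theorem dSw_add_fun (F G : Site 4 → Site 4 → ℝ) (x z : Site 4) (α β : Fin 4) :
    dSw (fun x z _ _ => F x z + G x z) x z α β = dSw (fun x z _ _ => F x z) x z α β + dSw (fun x z _ _ => G x z) x z α β := by
  simp only [dSw]
  ring

/-- [folklore] `dSw` is homogeneous in the entry function. -/
theorem dSw_smul_fun (c : ℝ) (F : Site 4 → Site 4 → ℝ) (x z : Site 4) (α β : Fin 4) :
    dSw (fun x z _ _ => c * F x z) x z α β = c * dSw (fun x z _ _ => F x z) x z α β := by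
  simp only [dSw]
  ring

/-- [folklore] `dSw` of an antisymmetrised tensor pair `f(x)g(z) − f(z)g(x)`:
`(f(x+e_α) − f x)(g(z+e_β) − g z) − (g(x+e_α) − g x)(f(z+e_β) − f z)`. -/
theorem dSw_antisym_pair (f g : Site 4 → ℝ) (x z : Site 4) (α β : Fin 4) :
    dSw (fun x z _ _ => f x * g z - f z * g x) x z α β =
      (f (x + unitVec α) - f x) * (g (z + unitVec β) - g z) - (g (x + unitVec α) - g x) * (f (z + unitVec β) - f z) := by
  simp only [dSw]
  ring

/-! ## §2 The projector sector entrywise on the road -/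

variable (n : ℕ) [NeZero n] (a : ℝ)

/-- [folklore] **THE PROJECTOR SECTOR `SbRblk` ENTRYWISE ON THE ROAD** (`0 < a`).  With the abbreviations (passed as hypotheses; instantiate with
`fun _ => rfl`): `RGx := RG (Ggh n a) (Pgt n a)`, the NEEDLE ROW `row x = Σ_{y ∈ B(blk u)} RGx(x,y)·qJet n κ u (blk u) y`, the COMBINED COLUMN
`C q = cQ·Σ_{z∈B(blk u)} Pgt(z,q) − kerP (n−1) a q (blk u)` and the DIPOLE `D x q = RGx(x,u+e_κ)·Pgt(u,q) − RGx(x,u)·Pgt(u+e_κ,q)`: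
`SbRblk n a cK cQ κ u (x,α) (z,β) = cK·ΔΔ[D − Dᵀ] − (row(x+e_α) − row x)·(C(z+e_β) − C z) + (C(x+e_α) − C x)·(row(z+e_β) − row z) − dJetSw κ u (Pgt n a) (x,α) (z,β)`,
where `ΔΔ[F] = F(x+e_α,z+e_β) − F(x+e_α,z) − F(x,z+e_β) + F(x,z)`. -/
theorem SbRblk_apply_road (ha : 0 < a) (cK cQ : ℝ) (κ : Fin 4) (u x z : Site 4) (α β : Fin 4)
    (row C : Site 4 → ℝ) (D : Site 4 → Site 4 → ℝ)
    (hrow : ∀ x : Site 4, row x = ∑ y ∈ B (n - 1) (blk (n - 1) u), RG (Ggh n a) (Pgt n a) x y () () * qJet n κ u (blk (n - 1) u) y)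
    (hC : ∀ q : Site 4, C q = cQ * (∑ z ∈ B (n - 1) (blk (n - 1) u), Pgt n a z q () ()) - kerP (d := 4) (n - 1) a q (blk (n - 1) u))
    (hD : ∀ x q : Site 4, D x q = RG (Ggh n a) (Pgt n a) x (u + unitVec κ) () () * Pgt n a u q () ()
      - RG (Ggh n a) (Pgt n a) x u () () * Pgt n a (u + unitVec κ) q () ()) :
    SbRblk n a cK cQ κ u x z α β =
      cK * (((D (x + unitVec α) (z + unitVec β) - D (z + unitVec β) (x + unitVec α))
              - (D (x + unitVec α) z - D z (x + unitVec α)))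
            - ((D x (z + unitVec β) - D (z + unitVec β) x) - (D x z - D z x)))
        - (row (x + unitVec α) - row x) * (C (z + unitVec β) - C z)
        + (C (x + unitVec α) - C x) * (row (z + unitVec β) - row z)
        - dJetSw κ u (Pgt n a) x z α β := by
  have hR : ∀ x' q' : Site 4, Rdot n a cK cQ κ u x' q' () () = cK * (D x' q' - D q' x') - row x' * C q' + row q' * C x' := by
    intro x' q'
    rw [Rdot_apply_road n a κ u ha cK cQ x' q' () (), hrow x', hrow q', hC x', hC q', hD x' q', hD q' x']
  rw [SbRblk_apply]
  show dSw (Rdot n a cK cQ κ u) x z α β - dJetSw κ u (Pgt n a) x z α β = _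
  rw [dSw_congr hR]
  ring

end

end Summit.QuantumFields.BalabanUV.Beta.D1BFx.SbRblkAnatomy
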